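import Mathlib

/-!
# `FeketeSOS.SublinearShadow` (stmt-ValiantsHypothesis-14990), line `Sketch`, reshape 5 — stub `stub_qfSquares`

**A quadratic form in `r` polynomials is `2r²` weighted squares.**  Over a field `K` with `2 ≠ 0` (so `4 = 2·2 ≠ 0`),
for `B : r × r → K` and `h₀, …, h_{r-1} ∈ K[X]` the polarisation identity
`B·(h h') = (B/4)·(h + h')² + (−B/4)·(h − h')²` gives
`Σ_{j,j'} B_{jj'} h_j h_{j'} = Σ_{(ε,j,j')} c_{ε j j'} g_{ε j j'}²` with `(c, g) = (B_{jj'}/4, h_j + h_{j'})` for `ε = 0`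
and `(−B_{jj'}/4, h_j − h_{j'})` for `ε = 1`; every square `h_j ± h_{j'}` is supported on `supp h_j ∪ supp h_{j'}`.
The `2r²` squares are indexed by `Fin (2 * (r * r)) ≃ Fin 2 × (Fin r × Fin r)` (`finProdFinEquiv`).
-/

namespace Summit.ValiantsHypothesis.ValiantsHypothesis.Theorems.SublinearShadowSketch

-- `Summit.ValiantsHypothesis.ValiantsHypothesis.…` is the tree's mandated single-conjunct layout (Sub = Summit).
set_option linter.dupNamespace false

open Polynomial Finset IsLocalRing Matrix
open scoped BigOperators

/-- Polarisation of one term: `(b/4)·(f + g)² + (−(b/4))·(f − g)² = b·(f g)` in `K[X]` when `2 ≠ 0` in `K`. -/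
theorem qfs_polarise {K : Type} [Field K] (h2 : (2 : K) ≠ 0) (b : K) (f g : K[X]) :
    C (b / 4) * (f + g) ^ 2 + C (-(b / 4)) * (f - g) ^ 2 = C b * (f * g) := by
  have h4 : (4 : K) ≠ 0 := by
    rw [show (4 : K) = 2 * 2 by norm_num]
    exact mul_ne_zero h2 h2
  have key : C (b / 4) * 4 = C b := by
    rw [← map_ofNat C 4, ← C_mul, div_mul_cancel₀ b h4]
  rw [C_neg]
  linear_combination (f * g) * key

/-- The support of a difference lies in the union of the supports. -/
theorem qfs_support_sub {R : Type} [Ring R] (f g : R[X]) : (f - g).support ⊆ f.support ∪ g.support := by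
  rw [sub_eq_add_neg]
  exact support_add.trans (by rw [support_neg])

/-- Each polarised square `h_j ± h_{j'}` is supported on `supp h_j ∪ supp h_{j'}`. -/
theorem qfs_support {K : Type} [Field K] {r : ℕ} (h : Fin r → K[X]) (t : Fin 2 × (Fin r × Fin r)) :
    (if t.1 = 0 then h t.2.1 + h t.2.2 else h t.2.1 - h t.2.2).support ⊆
      (h t.2.1).support ∪ (h t.2.2).support := by
  split_ifs
  · exact support_add
  · exact qfs_support_sub _ _

/-- The `Fin 2 × (Fin r × Fin r)`-indexed polarised family of weighted squares sums to the quadratic form. -/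
theorem qfs_sum_prod {K : Type} [Field K] (h2 : (2 : K) ≠ 0) (r : ℕ) (B : Fin r → Fin r → K)
    (h : Fin r → K[X]) :
    (∑ t : Fin 2 × (Fin r × Fin r),
        C (if t.1 = 0 then B t.2.1 t.2.2 / 4 else -(B t.2.1 t.2.2 / 4)) *
          (if t.1 = 0 then h t.2.1 + h t.2.2 else h t.2.1 - h t.2.2) ^ 2) =
      ∑ j, ∑ j', C (B j j') * (h j * h j') := by
  have h10 : (1 : Fin 2) ≠ 0 := by decide
  rw [Fintype.sum_prod_type, Fin.sum_univ_two, ← Finset.sum_add_distrib, Fintype.sum_prod_type]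
  refine Finset.sum_congr rfl fun j _ => Finset.sum_congr rfl fun j' _ => ?_
  dsimp only
  rw [if_pos rfl, if_pos rfl, if_neg h10, if_neg h10]
  exact qfs_polarise h2 (B j j') (h j) (h j')

/-- **Stub (G2): a quadratic form in `r` polynomials is `2r²` weighted squares** over a field with `2 ≠ 0`:
`B_{jj'} h_j h_{j'} = (B_{jj'}/4)((h_j + h_{j'})² − (h_j − h_{j'})²)`, each square supported on `supp h_j ∪ supp h_{j'}`.
[folklore] -/
theorem stub_qfSquares (K : Type) [Field K] (h2 : (2 : K) ≠ 0) (r : ℕ) (B : Fin r → Fin r → K)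
    (h : Fin r → Polynomial K) :
    ∃ (c' : Fin (2 * (r * r)) → K) (g' : Fin (2 * (r * r)) → Polynomial K),
      (∑ k, Polynomial.C (c' k) * g' k ^ 2) = ∑ j, ∑ j', Polynomial.C (B j j') * (h j * h j') ∧
      ∀ k, ∃ j j', (g' k).support ⊆ (h j).support ∪ (h j').support := by
  -- index the `2r²` squares by triples `(ε, j, j')`
  obtain ⟨e⟩ : Nonempty (Fin (2 * (r * r)) ≃ Fin 2 × (Fin r × Fin r)) :=
    ⟨(((Equiv.refl (Fin 2)).prodCongr finProdFinEquiv).trans finProdFinEquiv).symm⟩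
  refine ⟨fun k => if (e k).1 = 0 then B (e k).2.1 (e k).2.2 / 4 else -(B (e k).2.1 (e k).2.2 / 4),
    fun k => if (e k).1 = 0 then h (e k).2.1 + h (e k).2.2 else h (e k).2.1 - h (e k).2.2, ?_,
    fun k => ⟨(e k).2.1, (e k).2.2, qfs_support h (e k)⟩⟩
  -- transport the sum along `e` and split it over the product type
  rw [← qfs_sum_prod h2 r B h, ← Equiv.sum_comp e]
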